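import Summits.QuantumFields.BalabanUV.Gaps.EndDrawdownLinearFloorEntry
import Summits.QuantumFields.BalabanUV.Gaps.EndDrawdownLinearCeiling

/-!
# Gaps / EndDrawdownLinearThreshold — POSSIBILITY ON THE LINEAR ROAD READS THE CONSTANT: while FORCING over the (AF-1) class `|β¹_{k+1}| ≤ C·g_k`
# is constant-free (`EndDrawdownLinearRoad.endForcedLin_free`), POSSIBILITY is not — ONE explicit one-loop sequence, the OCTAL STAIRCASE
# `bOct j = −2^{−t}` on the position block `t = ⌊log₈(j+1)⌋` (`7·8^t` indices; rate halving while the block length grows EIGHTFOLD, `≍ −(j+1)^{−1∕3}`),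
# is POSSIBLE on the linear road with constant `C = 2` (`endPossibleLin_bOct_two`, by the FLOOR–ENTRY condition of `EndDrawdownLinearFloorEntry`:
# entry drawdown `(7∕3)·4^T` into the block start `8^T − 1` against the floor `C²·4^T` of the tail rate `2^{−T}`) and IMPOSSIBLE with constant
# `C = 1∕2` (`not_endPossibleLin_bOct_half`, by the DESCENDING-STAIRCASE OBSTRUCTION of `EndDrawdownLinearCeiling`: half-depth `(7∕2)·4^s` of block
# `s` against the ceiling gap `12C²·4^s`).  By `EndDrawdownCooperatorExtremal.endPossibleLin_mono` the set of admissible constants is an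
# up-set: `bOct` has a THRESHOLD `C⋆ ∈ [1∕2, 2]` (`linear_possibility_reads_the_constant`).  The three staircases side by side: base 16 (gen 9's
# `bStair`, budget `≍ 8^t` ≫ gap `≍ 4^t`): impossible for EVERY `C`; base 8 (`bOct`, budget `≍` gap `≍ 4^t`): a threshold in `C`; with recoveries
# (`EndDrawdownLinearRecovering.bRec`): possible for EVERY `C` (cell pub-balaban-gaps, seat g1-p3 GEN 10, rows CAP ∕ tail ∕ (D4) «split ∕
# weakening»; this seat's own leaf; file 22 of «the one-loop interface of the END statement»)

HONEST FRAMING (cell rule, page 1 of everything): [folklore] window arithmetic for ONE explicit toy sequence, fed to the kernel-checked floor–entry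
and ceiling–chain tests; `EndPossibleLin` is a quantified READING of the cell's END-grade statement over Bałaban-free data `(b, C, γ₀)`, not a
binder; the (AF-1) linear road is a located UNPRINTED hypothesis shape ([I] (2.12)–(2.14) ∕ [II] p. 8 after (1.29); `CapSignsConstRoad` §1);
NOTHING of Bałaban's table is certified (NODE-O 0∕1, CAP coefficients 0); words ∕ odds of rows CAP ∕ tail ∕ (D4) ∕ (D1) UNCHANGED; 0∕6
binders; one finite T⁴; NOT [I] Thm 2, NOT `BetaPertH`, NOT the continuum limit, NOT Clay.

CITATION HEADER (tags CONTEXT ONLY).  [I] = T. Bałaban, Commun. Math. Phys. **109** (1987) 249–301 [Balaban1987RG1]: (0.20) p. 256, Thm 2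
p. 259 (first sentence), (2.12)–(2.14) p. 268.
-/

namespace Summit.QuantumFields.BalabanUV.Gaps.EndDrawdownLinearThreshold

open Literature.MathematicalPhysics.QuantumFieldTheory.Balaban1983to89
open Literature.MathematicalPhysics.QuantumFieldTheory.Balaban1983to89.FlowStep
open Literature.MathematicalPhysics.QuantumFieldTheory.Balaban1983to89.FlowStepRuns
open Literature.MathematicalPhysics.QuantumFieldTheory.Balaban1983to89.DagBinding
open Summit.QuantumFields.BalabanUV.Gaps.EndDrawdownLinearRoad
open Summit.QuantumFields.BalabanUV.Gaps.EndDrawdownCooperatorExtremal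
open Summit.QuantumFields.BalabanUV.Gaps.EndDrawdownLinearFloorEntry
open Summit.QuantumFields.BalabanUV.Gaps.EndDrawdownLinearCeiling
open Finset

noncomputable section

/-! ## §1 The octal staircase -/

/-- The octal position block of index `j`: `blk8 j := ⌊log₈ (j+1)⌋`, block `t` = `{j : 8^t ≤ j+1 < 8^{t+1}}` (`7·8^t` indices). [folklore] -/
def blk8 (j : ℕ) : ℕ := Nat.log 8 (j + 1)

/-- The first index of octal block `t`: `8^t − 1`. [folklore] -/
def bs8 (t : ℕ) : ℕ := 8 ^ t - 1

/-- THE OCTAL STAIRCASE · `bOct j := −2^{−blk8 j}`: rate `1` on block `0`, halved on each successive block while the block length grows eightfold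
(`≍ −(j+1)^{−1∕3}`). A TOY. [folklore] -/
def bOct (j : ℕ) : ℝ := -(1 / 2 ^ blk8 j)

/-- Block membership. [folklore] -/
theorem blk8_of_mem {j t : ℕ} (h1 : 8 ^ t ≤ j + 1) (h2 : j + 1 < 8 ^ (t + 1)) : blk8 j = t :=
  (Nat.log_eq_iff (Or.inr ⟨by norm_num, Nat.succ_ne_zero j⟩)).mpr ⟨h1, h2⟩

/-- `bs8 t + 1 = 8^t`. [folklore] -/
theorem bs8_add_one (t : ℕ) : bs8 t + 1 = 8 ^ t := Nat.sub_add_cancel (Nat.one_le_pow _ _ (by norm_num))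

/-- `bs8 t ≤ j ⟺ t ≤ blk8 j`. [folklore] -/
theorem bs8_le_iff {t j : ℕ} : bs8 t ≤ j ↔ t ≤ blk8 j := by
  have h1 : bs8 t ≤ j ↔ 8 ^ t ≤ j + 1 := by have := bs8_add_one t; constructor <;> intro h <;> omega
  rw [h1]
  exact (Nat.le_log_iff_pow_le (by norm_num) (Nat.succ_ne_zero j)).symm

/-- Every term is negative: `bOct j ≤ 0`. [folklore] -/
theorem bOct_nonpos (j : ℕ) : bOct j ≤ 0 := by
  unfold bOct
  have : (0 : ℝ) < 1 / 2 ^ blk8 j := by positivity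
  linarith

/-- Beyond the block start `8^T − 1` the rate is at most `2^{−T}`: `−2^{−T} ≤ bOct j`. [folklore] -/
theorem bOct_ge_of_le {T j : ℕ} (hj : bs8 T ≤ j) : -(1 / 2 ^ T) ≤ bOct j := by
  have hT : T ≤ blk8 j := bs8_le_iff.mp hj
  unfold bOct
  have : (1 : ℝ) / 2 ^ blk8 j ≤ 1 / 2 ^ T := one_div_le_one_div_of_le (by positivity) (pow_le_pow_right₀ (by norm_num) hT)
  linarith

/-- On octal block `s` the rate is exactly `2^{−s}`: `bOct j ≤ −2^{−s}` for `bs8 s ≤ j < bs8 (s+1)`. [folklore] -/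
theorem bOct_le_of_mem {s j : ℕ} (h1 : bs8 s ≤ j) (h2 : j < bs8 (s + 1)) : bOct j ≤ -(1 / 2 ^ s) := by
  have hs := bs8_add_one s; have hs' := bs8_add_one (s + 1)
  have hblk : blk8 j = s := blk8_of_mem (by omega) (by omega)
  unfold bOct; rw [hblk]

/-- The total drawdown before the block start `8^T − 1` is `7(4^T − 1)∕3 ≤ (7∕3)·4^T`: `Σ_{j < 8^T − 1} bOct ≥ −(7∕3)·4^T`. [folklore] -/
theorem sum_bOct_prefix_ge (T : ℕ) : -(7 / 3 * 4 ^ T) ≤ ∑ j ∈ range (bs8 T), bOct j := by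
  induction T with
  | zero => norm_num [bs8]
  | succ T ih =>
    have hs := bs8_add_one T; have hs' := bs8_add_one (T + 1)
    have hp : 8 ^ (T + 1) = 8 * 8 ^ T := by rw [pow_succ, mul_comm]
    have hle : bs8 T ≤ bs8 (T + 1) := by omega
    rw [← Finset.sum_range_add_sum_Ico _ hle]
    have hblock : -(7 * 4 ^ T : ℝ) ≤ ∑ j ∈ Ico (bs8 T) (bs8 (T + 1)), bOct j := by
      have h1 : ∑ j ∈ Ico (bs8 T) (bs8 (T + 1)), (-(1 / 2 ^ T : ℝ)) ≤ ∑ j ∈ Ico (bs8 T) (bs8 (T + 1)), bOct j :=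
        Finset.sum_le_sum fun j hj => bOct_ge_of_le (Finset.mem_Ico.mp hj).1
      rw [Finset.sum_const, Nat.card_Ico, nsmul_eq_mul] at h1
      have hcard : ((bs8 (T + 1) - bs8 T : ℕ) : ℝ) = 7 * 8 ^ T := by
        have h2 : bs8 (T + 1) - bs8 T = 7 * 8 ^ T := by omega
        rw [h2]; push_cast; ring
      rw [hcard] at h1
      have e : (7 : ℝ) * 8 ^ T * (1 / 2 ^ T) = 7 * 4 ^ T := by
        rw [show (8 : ℝ) ^ T = 2 ^ T * 4 ^ T by rw [← mul_pow]; norm_num]; field_simp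
      linarith
    have e4 : (4 : ℝ) ^ (T + 1) = 4 * 4 ^ T := by rw [pow_succ, mul_comm]
    rw [e4]; linarith

/-- Every window inside `[0, 8^T − 1]` is at least the whole prefix: `Σ_{[i,K')} bOct ≥ −(7∕3)·4^T` for `K' ≤ 8^T − 1` (all terms `≤ 0`). [folklore] -/
theorem window_bOct_ge {T i K' : ℕ} (hK : K' ≤ bs8 T) : -(7 / 3 * 4 ^ T) ≤ ∑ j ∈ Ico i K', bOct j := by
  have hsub : Ico i K' ⊆ range (bs8 T) := fun j hj => by simp only [mem_Ico] at hj; simp only [mem_range]; omega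
  have h := Finset.sum_le_sum_of_subset_of_nonneg (f := fun j => -bOct j) hsub fun j _ _ => by linarith [bOct_nonpos j]
  simp only [Finset.sum_neg_distrib] at h
  linarith [sum_bOct_prefix_ge T]

/-! ## §2 Constant `C = 2`: possible (floor–entry) · constant `C = 1∕2`: impossible (ceiling–chain) -/

/-- **THE OCTAL STAIRCASE MEETS THE FLOOR–ENTRY CONDITION WITH `C = 2`**: at level `A` take `T` with `(5∕3)·4^T ≥ A`, checkpoint `8^T − 1`, tail rate
`2^{−T}` (floor `4·4^T`), entry ∕ internal drawdown `(7∕3)·4^T`. [folklore] -/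
theorem floorEntry_bOct_two {A : ℝ} (hA : 0 < A) :
    ∃ (I : ℕ) (ρ Dint Dent : ℝ), 0 < ρ ∧ (∀ j, I ≤ j → -ρ ≤ bOct j) ∧
      (∀ i K', i ≤ K' → K' ≤ I → -Dint ≤ ∑ j ∈ Ico i K', bOct j) ∧ (∀ i, i ≤ I → -Dent ≤ ∑ j ∈ Ico i I, bOct j) ∧
        A + Dent ≤ ((2 : ℝ) / ρ) ^ 2 := by
  obtain ⟨T, hT⟩ := pow_unbounded_of_one_lt A (by norm_num : (1 : ℝ) < 4)
  refine ⟨bs8 T, 1 / 2 ^ T, 7 / 3 * 4 ^ T, 7 / 3 * 4 ^ T, by positivity, fun j hj => bOct_ge_of_le hj,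
    fun _ _ _ hKI => window_bOct_ge hKI, fun _ _ => window_bOct_ge le_rfl, ?_⟩
  have e : ((2 : ℝ) / (1 / 2 ^ T)) ^ 2 = 4 * 4 ^ T := by
    rw [show (4 : ℝ) ^ T = (2 ^ T) ^ 2 by rw [← pow_mul, mul_comm, pow_mul]; norm_num]; field_simp; ring
  rw [e]; linarith

/-- **THE OCTAL STAIRCASE IS POSSIBLE ON THE LINEAR ROAD WITH CONSTANT `2`** (every box; hence with every `C ≥ 2`, `endPossibleLin_mono`).
[cite: Balaban1987RG1, Thm 2 p.259 (first sentence) and (2.12)–(2.14) p.268] -/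
theorem endPossibleLin_bOct_two {γ₀ : ℝ} (hγ₀ : 0 < γ₀) : EndPossibleLin bOct 2 γ₀ :=
  endPossibleLin_of_floorEntry two_pos hγ₀ fun _ hA => floorEntry_bOct_two hA

/-- **THE OCTAL STAIRCASE CONTAINS DESCENDING STAIRCASES FOR EVERY `C ≤ 1∕2`**: blocks `s = 0, …, T−1` (`idx s = 8^s − 1`, rates `2^{−s}`, top rate
`1`), half-depth of block `s` `= (7∕2)·4^s ≥ 12C²·4^s =` the ceiling gap, last half-depth `(7∕2)·4^{T−1} ≥ D`. [folklore] -/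
theorem staircase_bOct {C : ℝ} (hC : 0 < C) (hChalf : C ≤ 1 / 2) (D : ℝ) :
    ∃ (T : ℕ) (idx : ℕ → ℕ) (ε : ℕ → ℝ), 1 ≤ T ∧ (∀ s, s < T → idx s ≤ idx (s + 1)) ∧ (∀ s, s < T → 0 < ε s) ∧
      (1 : ℝ) ≤ ε 0 ∧ (∀ s, s < T → ∀ j, idx s ≤ j → j < idx (s + 1) → bOct j ≤ -ε s) ∧
      (∀ s, s + 1 < T → 4 * (C / ε (s + 1)) ^ 2 - 4 * (C / ε s) ^ 2 ≤ ((idx (s + 1) - idx s : ℕ) : ℝ) * (ε s / 2)) ∧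
      D ≤ ((idx T - idx (T - 1) : ℕ) : ℝ) * (ε (T - 1) / 2) := by
  obtain ⟨T₀, hT₀⟩ := pow_unbounded_of_one_lt D (by norm_num : (1 : ℝ) < 4)
  have hlen : ∀ s : ℕ, ((bs8 (s + 1) - bs8 s : ℕ) : ℝ) = 7 * 8 ^ s := fun s => by
    have hs := bs8_add_one s; have hs' := bs8_add_one (s + 1)
    have hp : 8 ^ (s + 1) = 8 * 8 ^ s := by rw [pow_succ, mul_comm]
    have h2 : bs8 (s + 1) - bs8 s = 7 * 8 ^ s := by omega
    rw [h2]; push_cast; ring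
  have hhalf : ∀ s : ℕ, ((bs8 (s + 1) - bs8 s : ℕ) : ℝ) * (1 / 2 ^ s / 2) = 7 / 2 * 4 ^ s := fun s => by
    rw [hlen s, show (8 : ℝ) ^ s = 2 ^ s * 4 ^ s by rw [← mul_pow]; norm_num]; field_simp
  refine ⟨T₀ + 1, bs8, fun s => 1 / 2 ^ s, by omega, fun s _ => ?_, fun s _ => by positivity, by norm_num,
    fun s _ j hj1 hj2 => bOct_le_of_mem hj1 hj2, fun s _ => ?_, ?_⟩
  · have := bs8_add_one s; have := bs8_add_one (s + 1); have : 8 ^ (s + 1) = 8 * 8 ^ s := (by rw [pow_succ, mul_comm])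
    omega
  · rw [hhalf s]
    have e1 : (C / (1 / 2 ^ (s + 1))) ^ 2 = C ^ 2 * (4 * 4 ^ s) := by
      rw [pow_succ, show (4 : ℝ) ^ s = (2 ^ s) ^ 2 by rw [← pow_mul, mul_comm, pow_mul]; norm_num]; field_simp; ring
    have e2 : (C / (1 / 2 ^ s)) ^ 2 = C ^ 2 * 4 ^ s := by
      rw [show (4 : ℝ) ^ s = (2 ^ s) ^ 2 by rw [← pow_mul, mul_comm, pow_mul]; norm_num]; field_simp
    rw [e1, e2]
    have hC2 : C ^ 2 ≤ 1 / 4 := by nlinarith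
    have h4 : (0 : ℝ) < 4 ^ s := by positivity
    nlinarith
  · rw [show T₀ + 1 - 1 = T₀ by omega, hhalf T₀]
    have : (0 : ℝ) < 4 ^ T₀ := by positivity
    linarith

/-- **THE OCTAL STAIRCASE IS IMPOSSIBLE ON THE LINEAR ROAD WITH EVERY CONSTANT `C ≤ 1∕2`** (every box).
[cite: Balaban1987RG1, Thm 2 p.259 (first sentence) and (2.12)–(2.14) p.268] -/
theorem not_endPossibleLin_bOct_half {C : ℝ} (hC : 0 < C) (hChalf : C ≤ 1 / 2) {γ₀ : ℝ} (hγ₀ : 0 < γ₀) : ¬ EndPossibleLin bOct C γ₀ :=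
  not_endPossibleLin_of_staircase hC one_pos (fun D => staircase_bOct hC hChalf D) hγ₀

/-! ## §3 The threshold -/

/-- **POSSIBILITY ON THE LINEAR ROAD READS THE CONSTANT** · ONE one-loop sequence is possible over the (AF-1) class with every constant `C ≥ 2`
and impossible with every constant `0 < C ≤ 1∕2`, on every box — whereas FORCING over the class is constant-free
(`EndDrawdownLinearRoad.endForcedLin_free`). [cite: Balaban1987RG1, Thm 2 p.259 (first sentence) and (2.12)–(2.14) p.268] -/
theorem linear_possibility_reads_the_constant :
    ∃ b : ℕ → ℝ, (∀ C γ₀ : ℝ, 2 ≤ C → 0 < γ₀ → EndPossibleLin b C γ₀) ∧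
      ∀ C γ₀ : ℝ, 0 < C → C ≤ 1 / 2 → 0 < γ₀ → ¬ EndPossibleLin b C γ₀ :=
  ⟨bOct, fun _ _ hC hγ₀ => endPossibleLin_mono hC (endPossibleLin_bOct_two hγ₀),
    fun _ _ hC hChalf hγ₀ => not_endPossibleLin_bOct_half hC hChalf hγ₀⟩

/-- **A THRESHOLD CONSTANT** · the admissible constants of `bOct` form an up-set (`endPossibleLin_mono`) containing `2` and missing `]0, 1∕2]`:
there is `C⋆ ∈ [1∕2, 2]` with `EndPossibleLin bOct C γ₀` for every `C > C⋆` and `¬ EndPossibleLin bOct C γ₀` for every `0 < C < C⋆` (any box).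
[folklore] -/
theorem exists_threshold_bOct {γ₀ : ℝ} (hγ₀ : 0 < γ₀) :
    ∃ Cstar : ℝ, 1 / 2 ≤ Cstar ∧ Cstar ≤ 2 ∧ (∀ C, Cstar < C → EndPossibleLin bOct C γ₀) ∧
      ∀ C, 0 < C → C < Cstar → ¬ EndPossibleLin bOct C γ₀ := by
  set S : Set ℝ := {C | 0 < C ∧ EndPossibleLin bOct C γ₀} with hS
  have h2 : (2 : ℝ) ∈ S := ⟨two_pos, endPossibleLin_bOct_two hγ₀⟩
  have hbdd : BddBelow S := ⟨1 / 2, fun C hC => le_of_not_gt fun hlt => not_endPossibleLin_bOct_half hC.1 hlt.le hγ₀ hC.2⟩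
  refine ⟨sInf S, le_csInf ⟨2, h2⟩ fun C hC => le_of_not_gt fun hlt => not_endPossibleLin_bOct_half hC.1 hlt.le hγ₀ hC.2,
    csInf_le hbdd h2, fun C hC => ?_, fun C hC0 hC hP => ?_⟩
  · obtain ⟨C', hC'S, hC'C⟩ := exists_lt_of_csInf_lt ⟨2, h2⟩ hC
    exact endPossibleLin_mono hC'C.le hC'S.2
  · exact absurd (csInf_le hbdd ⟨hC0, hP⟩) (not_le.mpr hC)

end

end Summit.QuantumFields.BalabanUV.Gaps.EndDrawdownLinearThreshold
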